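import Mathlib
import Literature.Computability.AlgebraicComplexity.HessianAtOrigin
import Literature.Computability.AlgebraicComplexity.MignonRessayreBound
import Summits.ValiantsHypothesis.ValiantsHypothesis.Theorems.GrenetZeonTwoDimCoefficientsPermanentFlatOrderEval
import Summits.ValiantsHypothesis.ValiantsHypothesis.Theorems.GrenetZeonTwoDimCoefficientsDualUnipotentFlat
import Summits.ValiantsHypothesis.ValiantsHypothesis.Theorems.GrenetZeonTwoDimCoefficientsDualUnipotentHessianRate
import Summits.ValiantsHypothesis.ValiantsHypothesis.Theorems.GrenetZeonTwoDimCoefficientsDualUnipotentThinNumeratorCalculus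

/-!
# Crux `GrenetZeon.TwoDimCoefficients` (stmt-ValiantsHypothesis-8062, stub `stub_dualUnipotent`) and its 3/2 rung
# `DualUnipotentThreeHalves` (stmt-ValiantsHypothesis-24318): the THIN-NUMERATOR HESSIAN BOUND for `tr(adj A · B)`

The plan of record for the rung 24318 is ✓ `threeHalves_of_hessianRate` (`…DualUnipotentHessianRate`), whose
hypothesis `hC` — CONJECTURE (H) HessianRate — asks, for affine `A`, `B` with `det A ≡ c ≠ 0`, for the bound
`rank Hess_p tr(adj A·B) · d ≤ C·m²` at EVERY point `p` (`d` the degree).  (H) is proved in the tree on the layered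
family only (leafhand g10: `…LayeredHessianRate{,Assembly}`, row-block form, five files), is tight on trace chains
(✓ `rank_hessMat`), and is the exact ceiling of Hessian-profile methods (✓ `not_dualUnipotentBound_of_hessianProfile`).

This file (part 2 of 2; part 1 = `…DualUnipotentThinNumeratorCalculus`: resolvent calculus `c·D(adj A) = −adj A·D(A)·adj A`,
the evaluated second derivative, rank bookkeeping) proves, in the OFFICIAL `hess0 ∘ transl` currency of `hC` and with no
hypothesis on `A` beyond affinity and `det A ≡ c ≠ 0`, a pointwise Hessian bound that sees ONLY THE NUMERATOR `B`:

* ★ `rank_hess0_transl_trace_adjugate_mul_le_numerator` — at every point `p`,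
  `rank Hess_p tr(adj A · B) ≤ 2·m·rank B(p) + 2·rank coeff(B)`,
  where `coeff(B)` is the `(m·m) × σ` matrix of linear coefficients of the entries of `B` (its rank = the number of
  linearly independent linear parts among the entries of `B`).  So (H) holds, with `C·m² := 2d·(m·w + r)`, for every
  presentation whose numerator has pointwise rank `≤ w` and `≤ r` independent linear forms — e.g. the natural
  presentation of the single-window layered family `tr(X_0 ⋯ X_{d−1})` (`A = 1 −` the block-superdiagonal chain of
  `X_0, …, X_{d−2}`, `B =` the corner block `X_{d−1}`, a `t × t'` block of variables between consecutive levels of widths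
  `t`, `t'`: `rank B(p) ≤ t`, `r ≤ t·t' ≤ t·m`, so `rank Hess ≤ 4mt ≤ 4m²/d` when `t ≤ m/d` is the THINNEST level — by
  cyclicity of the trace the corner may be placed there), at all points at once.
* `hess0_transl_trace_adjugate_mul_apply` / `…_eq` — the mechanism: with `J = adj A(p)`, `A_s`, `B_s` the coefficient
  matrices of `x_s`, the Hessian is `H = c⁻²·(Φ₁ + Φ₁ᵀ) − c⁻¹·(Φ₂ᵀ + Φ₂)`, `Φ₁(s,t) = tr(J A_s J A_t J B(p))`,
  `Φ₂(s,t) = tr(J A_s J B_t)` (second derivative of the resolvent: `c·D(adj A) = −adj A·D(A)·adj A`,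
  `C_smul_map_adjugate_derivation`); `rank Φ₁ ≤ m·rank(J B(p))` (`rank_of_trace_mul_mul_le`: `Φ₁ = Σ_i P_i Mᵀ Q_i`),
  `rank Φ₂ ≤ rank coeff(B)` (`rank_of_trace_mul_mul_coeff_le`: `Φ₂ = P·E·coeff(B)`).
* `sq_le_numerator_of_repr` — per-side reading at the Mignon–Ressayre point `p₀` (✓ `rank_mrHess`): in any
  representation `per_n = α·det A + β·tr(adj A·B)` with `A`, `B` affine and `det A ≡ c ≠ 0`,
  `n² ≤ 2·m·rank B(p₀) + 2·rank coeff(B)` — the numerator of a unipotent-dual representation of the permanent is never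
  thin (either `B(p₀)` has rank `≥ n²/(4m)` or `B` carries `≥ n²/4` independent linear forms).

What this does NOT do (honest framing): the cross term `Φ₂` is bounded by the numerator's linear rank, which for a
general representation of `per_n` can be of order `n²`; the bound says nothing about WILD pencils with a fat numerator,
so neither (H) in general, nor `stub_dualUnipotent`, nor the rung 24318, nor its stub `stub_longMassSlowLawInv`, nor
`VP ≠ VNP` is proved or moved.  It is a helper landed `--supports stmt-ValiantsHypothesis-8062 --as helper`: the
`hess0`-side identification of the resolvent Hessian (the «(★) tr(UPU'Q) + tr(UQU'P)» form of the g10 note, R1 of its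
remaining list, in general form) plus the numerator-only rank count.  No definitions, no named facts.

References: T. Mignon, N. Ressayre, Int. Math. Res. Not. 2004:79, Thm. 1.1 (the Hessian-rank method; key
`MignonRessayre2004`); J. M. Landsberg, *Geometry and Complexity Theory*, CUP 2017, §6.4 (key `LandsbergGCT2017`).
-/

noncomputable section

set_option linter.dupNamespace false

namespace Summit.ValiantsHypothesis.ValiantsHypothesis.Theorems.GrenetZeon.ThinNumerator

open MvPolynomial Matrix
open Literature.Computability.AlgebraicComplexity
open Summit.ValiantsHypothesis.ValiantsHypothesis.Cruxes.TwoDimCoefficients.DimTwoCases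
  (mkDerivation_const_eq_zero mkDerivation_C_apply_eq_sum mkDerivation_mkDerivation_eq_zero_of_totalDegree_le_one
   mkDerivation_eq_C_of_totalDegree_le_one toBilin_hess0_transl_eq_eval perPoly_ne_C)

/-! ### §4 The Hessian of `tr(adj A · B)` at a point, for affine `A`, `B` with `det A ≡ c ≠ 0` -/

section Hessian

variable {σ : Type*} [Fintype σ] [DecidableEq σ] {m : ℕ}

omit [DecidableEq σ] in
/-- Second directional derivatives of an affine matrix vanish. [folklore] -/
theorem map_dirD_map_dirD_eq_zero (P : Matrix (Fin m) (Fin m) (MvPolynomial σ ℂ))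
    (hP : ∀ i j, (P i j).totalDegree ≤ 1) (u v : σ → ℂ) :
    (P.map (mkDerivation ℂ (fun s => (C (v s) : MvPolynomial σ ℂ)))).map
      (mkDerivation ℂ (fun s => (C (u s) : MvPolynomial σ ℂ))) = 0 :=
  Matrix.ext fun i j => mkDerivation_mkDerivation_eq_zero_of_totalDegree_le_one u v (hP i j)

/-- The coordinate derivative `∂_s` of an affine matrix, evaluated anywhere, is its coefficient matrix of `x_s`.
[folklore] -/
theorem map_dirD_single_map_eval (P : Matrix (Fin m) (Fin m) (MvPolynomial σ ℂ))
    (hP : ∀ i j, (P i j).totalDegree ≤ 1) (s : σ) (p : σ → ℂ) :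
    (P.map (mkDerivation ℂ (fun w => (C ((Pi.single s (1 : ℂ) : σ → ℂ) w) : MvPolynomial σ ℂ)))).map
      (eval p) = P.map (coeff (Finsupp.single s 1)) := by
  refine Matrix.ext fun i j => ?_
  rw [Matrix.map_apply, Matrix.map_apply, Matrix.map_apply,
    mkDerivation_eq_C_of_totalDegree_le_one _ (hP i j), eval_C]
  simp only [Pi.single_apply, ite_mul, one_mul, zero_mul, Finset.sum_ite_eq', Finset.mem_univ,
    if_true]

/-- **Entries of the Hessian of `tr(adj A · B)` at a point `p`** (`A`, `B` affine, `det A ≡ c ≠ 0`): with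
`J = adj A(p)`, `A_s` / `B_s` the coefficient matrices of `x_s`, and `B(p)`,
`H_{st} = c⁻²·tr((J A_s J A_t J + J A_t J A_s J)·B(p)) − c⁻¹·tr(J A_t J B_s) − c⁻¹·tr(J A_s J B_t)`. [folklore] -/
theorem hess0_transl_trace_adjugate_mul_apply (A B : Matrix (Fin m) (Fin m) (MvPolynomial σ ℂ))
    (hA : ∀ i j, (A i j).totalDegree ≤ 1) (hB : ∀ i j, (B i j).totalDegree ≤ 1) {c : ℂ} (hc : c ≠ 0)
    (hdet : A.det = C c) (p : σ → ℂ) (s t : σ) :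
    hess0 (transl p (A.adjugate * B).trace) s t =
      c⁻¹ * c⁻¹ * (((A.map (eval p)).adjugate * A.map (coeff (Finsupp.single s 1)) * (A.map (eval p)).adjugate *
          A.map (coeff (Finsupp.single t 1)) * (A.map (eval p)).adjugate +
        (A.map (eval p)).adjugate * A.map (coeff (Finsupp.single t 1)) * (A.map (eval p)).adjugate *
          A.map (coeff (Finsupp.single s 1)) * (A.map (eval p)).adjugate) * B.map (eval p)).trace
      - c⁻¹ * ((A.map (eval p)).adjugate * A.map (coeff (Finsupp.single t 1)) * (A.map (eval p)).adjugate *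
          B.map (coeff (Finsupp.single s 1))).trace
      - c⁻¹ * ((A.map (eval p)).adjugate * A.map (coeff (Finsupp.single s 1)) * (A.map (eval p)).adjugate *
          B.map (coeff (Finsupp.single t 1))).trace := by
  rw [← Matrix.toBilin'_single (hess0 (transl p (A.adjugate * B).trace)) s t, toBilin_hess0_transl_eq_eval]
  exact eval_derivation_derivation_trace_adjugate_mul _ _ A B hc hdet (map_dirD_map_dirD_eq_zero A hA _ _)
    (map_dirD_map_dirD_eq_zero B hB _ _) p _ _ _ _ _ _ rfl (map_dirD_single_map_eval A hA s p)
    (map_dirD_single_map_eval A hA t p) (map_dirD_single_map_eval B hB s p)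
    (map_dirD_single_map_eval B hB t p) rfl

/-- **The Hessian of `tr(adj A · B)` at `p` as a matrix**: `H = c⁻²·(Φ₁ + Φ₁ᵀ) − c⁻¹·(Φ₂ᵀ + Φ₂)` with
`Φ₁(s,t) = tr(J A_s J A_t J B(p))` and `Φ₂(s,t) = tr(J A_s J B_t)`. [folklore] -/
theorem hess0_transl_trace_adjugate_mul_eq (A B : Matrix (Fin m) (Fin m) (MvPolynomial σ ℂ))
    (hA : ∀ i j, (A i j).totalDegree ≤ 1) (hB : ∀ i j, (B i j).totalDegree ≤ 1) {c : ℂ} (hc : c ≠ 0)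
    (hdet : A.det = C c) (p : σ → ℂ) :
    hess0 (transl p (A.adjugate * B).trace) =
      (c⁻¹ * c⁻¹) • ((Matrix.of fun s t : σ => ((A.map (eval p)).adjugate * A.map (coeff (Finsupp.single s 1)) *
            (A.map (eval p)).adjugate * A.map (coeff (Finsupp.single t 1)) * (A.map (eval p)).adjugate *
            B.map (eval p)).trace) +
        (Matrix.of fun s t : σ => ((A.map (eval p)).adjugate * A.map (coeff (Finsupp.single s 1)) *
            (A.map (eval p)).adjugate * A.map (coeff (Finsupp.single t 1)) * (A.map (eval p)).adjugate *
            B.map (eval p)).trace)ᵀ) +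
      (-c⁻¹) • ((Matrix.of fun s t : σ => ((A.map (eval p)).adjugate * A.map (coeff (Finsupp.single s 1)) *
            (A.map (eval p)).adjugate * B.map (coeff (Finsupp.single t 1))).trace)ᵀ +
        (Matrix.of fun s t : σ => ((A.map (eval p)).adjugate * A.map (coeff (Finsupp.single s 1)) *
            (A.map (eval p)).adjugate * B.map (coeff (Finsupp.single t 1))).trace)) := by
  refine Matrix.ext fun s t => ?_
  rw [hess0_transl_trace_adjugate_mul_apply A B hA hB hc hdet p s t]
  simp only [Matrix.add_apply, Matrix.smul_apply, Matrix.transpose_apply, Matrix.of_apply, Matrix.add_mul,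
    Matrix.trace_add, smul_eq_mul]
  ring

end Hessian

/-! ### §5 The thin-numerator Hessian bound -/

section Main

variable {σ : Type*} [Fintype σ] [DecidableEq σ] {m : ℕ}

/-- ★ **THIN-NUMERATOR HESSIAN BOUND.**  Let `A`, `B` be `m × m` matrices of affine linear forms over `ℂ[x_σ]`
with `det A ≡ c ≠ 0`.  Then at EVERY point `p`

  `rank Hess_p tr(adj A · B) ≤ 2·m·rank B(p) + 2·rank(coefficient matrix of B)`,

where the coefficient matrix of `B` (rows: entries `(l,k)`, columns: variables `t`, entry `coeff_{x_t} B_{lk}`) has rank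
equal to the number of linearly independent linear parts among the entries of `B`.  Proof: `H = c⁻²(Φ₁ + Φ₁ᵀ) −
c⁻¹(Φ₂ᵀ + Φ₂)` (`hess0_transl_trace_adjugate_mul_eq`), `rank Φ₁ ≤ m·rank(adj A(p)·B(p)) ≤ m·rank B(p)`
(`rank_of_trace_mul_mul_le`), `rank Φ₂ ≤ rank coeff(B)` (`rank_of_trace_mul_mul_coeff_le`).  No hypothesis on `A`
beyond affinity and `det A ≡ c`; the bound is blind to the (nilpotent) pencil of `A` and sees only the numerator `B`.
[folklore] -/
theorem rank_hess0_transl_trace_adjugate_mul_le_numerator (A B : Matrix (Fin m) (Fin m) (MvPolynomial σ ℂ))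
    (hA : ∀ i j, (A i j).totalDegree ≤ 1) (hB : ∀ i j, (B i j).totalDegree ≤ 1) {c : ℂ} (hc : c ≠ 0)
    (hdet : A.det = C c) (p : σ → ℂ) :
    (hess0 (transl p (A.adjugate * B).trace)).rank ≤
      2 * (m * (B.map (eval p)).rank) +
        2 * (Matrix.of fun (lk : Fin m × Fin m) (t : σ) => coeff (Finsupp.single t 1) (B lk.1 lk.2)).rank := by
  rw [hess0_transl_trace_adjugate_mul_eq A B hA hB hc hdet p]
  set Jp := (A.map (eval p)).adjugate with hJp
  set U : σ → Matrix (Fin m) (Fin m) ℂ := fun s => Jp * A.map (coeff (Finsupp.single s 1)) with hU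
  set Φ₁ : Matrix σ σ ℂ := Matrix.of fun s t : σ =>
    (Jp * A.map (coeff (Finsupp.single s 1)) * Jp * A.map (coeff (Finsupp.single t 1)) * Jp * B.map (eval p)).trace
    with hΦ₁
  set Φ₂ : Matrix σ σ ℂ := Matrix.of fun s t : σ =>
    (Jp * A.map (coeff (Finsupp.single s 1)) * Jp * B.map (coeff (Finsupp.single t 1))).trace with hΦ₂
  -- `Φ₁`, `Φ₂` in the shape of §4
  have hΦ₁' : Φ₁ = Matrix.of fun s t : σ => (U s * U t * (Jp * B.map (eval p))).trace := by
    refine Matrix.ext fun s t => ?_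
    simp only [hΦ₁, hU, Matrix.of_apply, Matrix.mul_assoc]
  have hΦ₂' : Φ₂ = Matrix.of fun s t : σ => (U s * Jp * B.map (coeff (Finsupp.single t 1))).trace := by
    refine Matrix.ext fun s t => ?_
    simp only [hΦ₂, hU, Matrix.of_apply, Matrix.mul_assoc]
  have h1 : Φ₁.rank ≤ m * (B.map (eval p)).rank := by
    rw [hΦ₁']
    exact (rank_of_trace_mul_mul_le U _).trans (Nat.mul_le_mul_left _ (Matrix.rank_mul_le_right _ _))
  have h2 : Φ₂.rank ≤
      (Matrix.of fun (lk : Fin m × Fin m) (t : σ) => coeff (Finsupp.single t 1) (B lk.1 lk.2)).rank := by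
    rw [hΦ₂']
    exact rank_of_trace_mul_mul_coeff_le U Jp B
  have h1T : Φ₁ᵀ.rank ≤ m * (B.map (eval p)).rank := (Matrix.rank_transpose Φ₁).le.trans h1
  have h2T : Φ₂ᵀ.rank ≤
      (Matrix.of fun (lk : Fin m × Fin m) (t : σ) => coeff (Finsupp.single t 1) (B lk.1 lk.2)).rank :=
    (Matrix.rank_transpose Φ₂).le.trans h2
  refine (rank_add_le' _ _).trans ?_
  refine Nat.add_le_add ?_ ?_
  · refine (rank_smul_le _ _).trans ((rank_add_le' _ _).trans ?_)
    omega
  · refine (rank_smul_le _ _).trans ((rank_add_le' _ _).trans ?_)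
    omega

/-- **Per-side reading: the numerator of a unipotent-dual representation of the permanent is not thin.**  If
`per_n = α·det A + β·tr(adj A · B)` (`n ≥ 3`) with `A`, `B` affine `m × m` and `det A ≡ c ≠ 0`, then at the
Mignon–Ressayre point `p₀` (where `rank Hess per_n = n²`, ✓ `rank_mrHess`)
`n² ≤ 2·m·rank B(p₀) + 2·rank coeff(B)`. [folklore] -/
theorem sq_le_numerator_of_repr (k : ℕ) {α β c : ℂ}
    (A B : Matrix (Fin m) (Fin m) (MvPolynomial (Fin (k + 3) × Fin (k + 3)) ℂ))
    (hA : ∀ i j, (A i j).totalDegree ≤ 1) (hB : ∀ i j, (B i j).totalDegree ≤ 1) (hc : c ≠ 0)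
    (hdet : A.det = C c)
    (hper : perPoly (Fin (k + 3)) ℂ = C α * A.det + C β * (A.adjugate * B).trace) :
    (k + 3) ^ 2 ≤
      2 * (m * (B.map (eval (mrPoint ℂ k))).rank) +
        2 * (Matrix.of fun (lk : Fin m × Fin m) (t : Fin (k + 3) × Fin (k + 3)) =>
          coeff (Finsupp.single t 1) (B lk.1 lk.2)).rank := by
  set T : MvPolynomial (Fin (k + 3) × Fin (k + 3)) ℂ := (A.adjugate * B).trace with hT
  -- `β ≠ 0`: otherwise the permanent would be the constant `α c`
  have hβ : β ≠ 0 := by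
    intro hβ0
    apply perPoly_ne_C (n := k + 3) (by omega) (α * c)
    rw [hper, hdet, hβ0, map_zero, zero_mul, add_zero, ← C_mul]
  -- the Hessian of `per_n` at the MR point is `β •` the Hessian of `T`
  have e1 : transl (mrPoint ℂ k) (perPoly (Fin (k + 3)) ℂ) =
      MvPolynomial.C (α * c) + MvPolynomial.C β * transl (mrPoint ℂ k) T := by
    rw [hper, hdet, map_add, map_mul, map_mul, transl_C, transl_C, transl_C, ← C_mul]
  have hHess : hess0 (transl (mrPoint ℂ k) (perPoly (Fin (k + 3)) ℂ)) =
      β • hess0 (transl (mrPoint ℂ k) T) := by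
    rw [e1, map_add, hess0_C_mul,
      hess0_eq_zero_of_totalDegree_le_one (by rw [totalDegree_C]; exact Nat.zero_le _), zero_add]
  have hrank : (hess0 (transl (mrPoint ℂ k) T)).rank = (k + 3) ^ 2 := by
    rw [← rank_smul_eq hβ, ← hHess, hess0_transl_mrPoint_perPoly,
      rank_smul_eq (by exact_mod_cast Nat.factorial_ne_zero k), rank_mrHess]
  rw [← hrank, hT]
  exact rank_hess0_transl_trace_adjugate_mul_le_numerator A B hA hB hc hdet (mrPoint ℂ k)

end Main

/-! ### §6 (appended) The CROSS FORM as the named obstruction -/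

section Cross

variable {σ : Type*} [Fintype σ] [DecidableEq σ] {m : ℕ}

/-- ★ **Numerator bound with the cross form kept explicit.**  For affine `A`, `B` with `det A ≡ c ≠ 0` and every point `p`:
`rank Hess_p tr(adj A·B) ≤ 2·m·rank B(p) + 2·rank Φ₂`, where `Φ₂(s,t) = tr(J A_s J B_t)` (`J = adj A(p)`, `A_s`, `B_t` the
coefficient matrices of `x_s`, `x_t`) is the CROSS FORM pairing the directions of the pencil `A` with those of the numerator
`B`.  `rank Φ₂ ≤ rank coeff(B)` (✓ `rank_of_trace_mul_mul_coeff_le`) recovers the thin-numerator bound; any sharper bound on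
`Φ₂` restricted to a constrained pencil (trace constraints `tr(N^j M) ≡ 0`, `j ≠ d − 1`) is exactly what CONJECTURE (H)
HessianRate needs on wild pencils with a fat numerator — the located open piece (R3 of the leafhand census). [folklore] -/
theorem rank_hess0_transl_trace_adjugate_mul_le_cross (A B : Matrix (Fin m) (Fin m) (MvPolynomial σ ℂ))
    (hA : ∀ i j, (A i j).totalDegree ≤ 1) (hB : ∀ i j, (B i j).totalDegree ≤ 1) {c : ℂ} (hc : c ≠ 0)
    (hdet : A.det = C c) (p : σ → ℂ) :
    (hess0 (transl p (A.adjugate * B).trace)).rank ≤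
      2 * (m * (B.map (eval p)).rank) +
        2 * (Matrix.of fun s t : σ => ((A.map (eval p)).adjugate * A.map (coeff (Finsupp.single s 1)) *
          (A.map (eval p)).adjugate * B.map (coeff (Finsupp.single t 1))).trace).rank := by
  rw [hess0_transl_trace_adjugate_mul_eq A B hA hB hc hdet p]
  set Jp := (A.map (eval p)).adjugate with hJp
  set U : σ → Matrix (Fin m) (Fin m) ℂ := fun s => Jp * A.map (coeff (Finsupp.single s 1)) with hU
  set Φ₁ : Matrix σ σ ℂ := Matrix.of fun s t : σ =>
    (Jp * A.map (coeff (Finsupp.single s 1)) * Jp * A.map (coeff (Finsupp.single t 1)) * Jp * B.map (eval p)).trace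
    with hΦ₁
  set Φ₂ : Matrix σ σ ℂ := Matrix.of fun s t : σ =>
    (Jp * A.map (coeff (Finsupp.single s 1)) * Jp * B.map (coeff (Finsupp.single t 1))).trace with hΦ₂
  have hΦ₁' : Φ₁ = Matrix.of fun s t : σ => (U s * U t * (Jp * B.map (eval p))).trace := by
    refine Matrix.ext fun s t => ?_
    simp only [hΦ₁, hU, Matrix.of_apply, Matrix.mul_assoc]
  have h1 : Φ₁.rank ≤ m * (B.map (eval p)).rank := by
    rw [hΦ₁']
    exact (rank_of_trace_mul_mul_le U _).trans (Nat.mul_le_mul_left _ (Matrix.rank_mul_le_right _ _))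
  have h1T : Φ₁ᵀ.rank ≤ m * (B.map (eval p)).rank := (Matrix.rank_transpose Φ₁).le.trans h1
  have h2T : Φ₂ᵀ.rank ≤ Φ₂.rank := (Matrix.rank_transpose Φ₂).le
  refine (rank_add_le' _ _).trans ?_
  refine Nat.add_le_add ?_ ?_
  · refine (rank_smul_le _ _).trans ((rank_add_le' _ _).trans ?_)
    omega
  · refine (rank_smul_le _ _).trans ((rank_add_le' _ _).trans ?_)
    omega

end Cross

end Summit.ValiantsHypothesis.ValiantsHypothesis.Theorems.GrenetZeon.ThinNumerator

end
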